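import Summits.BirchSwinnertonDyer.BirchSwinnertonDyer.Theses.TameQuarticManinParity
import Literature.NumberTheory.EllipticCurves.ModularJacobianNeronLatticeCuspCriterion
import Literature.NumberTheory.EllipticCurves.Gamma0RankinSelbergPairing
import Summits.BirchSwinnertonDyer.Rank1Residual.O5.CharTwistThreeIsometry
import Summits.BirchSwinnertonDyer.BirchSwinnertonDyer.Theorems.TameQuarticManinParityALStableThreeCuspRegularOfAdjunction
import HarnessLib

/-!
# Route `TameQuarticManinParity` (landed by leaf hand `leafhand-bsd-tamequarticmaninpa-1-g0`, see LANDING NOTE), glue item `CuspRegularResidueLawOfResiduesOnE` (stmt-BirchSwinnertonDyer-23766):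
# `MiddleResidueRankBound → TwistedOldformResidueBasis → FourierCoeffAtCuspLinear → CuspRegularResidueLaw`

LINE 50 of the ideator seat bsd-idea-3 (g14), «middle residues live on the Katz–Mazur `(1,1)`-component».
This file proves ONLY the glue (split of RL47 `CuspRegularResidueLaw`, route rev 84): `𝔽₃`-linear algebra —
pigeonhole from `MiddleResidueRankBound` (R50a) applied to `b` and the `m ≥ D(N)` twisted oldforms of
`TwistedOldformResidueBasis` (R50b), Bezout on the coefficient of `b`, `3·L_reg ⊆ L_strict`, and ultrametric
closure of the cusp bounds under `ℤ`-combinations via `FourierCoeffAtCuspLinear` (S50).  The cruxes R50a, R50b and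
the support S50 are NOT proved here; RL47, the rung chain above it and BSD are NOT proved.  No `sorry`.
LANDING NOTE (leaf hand `leafhand-bsd-tamequarticmaninpa-1-g0`, 2026-08-30, cone of the cruxes 23736/23737, announced on the
bsd-eis STATUS before proposing): this is the planner-of-record's LANDING-READY file `ideators/bsd-idea-3/ideas/l50/Glue50-land.lean`
(bsd-idea-3 g14, sha16 39b10b09bff9e2db, unlanded since 2026-08-29T22:08Z) with ONE mechanical change — the three proof-local
abbreviations `regB` / `BndP` / `IsRat` (defs) are inlined as the explicit `∀`-statements they stood for, so the file declares
theorems only; the proof scripts are otherwise the pen's, unchanged.  Glue only; R50a/R50b/RL47 stay OPEN; BSD is NOT proved.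
-/

set_option autoImplicit false
-- D-0017: single-problem summit, so `Summit.BirchSwinnertonDyer.BirchSwinnertonDyer.…` repeats a namespace BY DESIGN.
set_option linter.dupNamespace false

open Literature.NumberTheory.EllipticCurves.ModularForms CongruenceSubgroup
open scoped MatrixGroups

namespace Summit.BirchSwinnertonDyer.BirchSwinnertonDyer.Theorems.TameQuarticManinParity.ResiduesOnE

open Summit.BirchSwinnertonDyer.BirchSwinnertonDyer.Theses.TameQuarticManinParity

variable {N : ℕ} [NeZero N]

section closure
variable (hL : FourierCoeffAtCuspLinear)
include hL

/-- Cusp bounds `‖ι⁻¹ a_f(n;γ)‖ ≤ B γ` (at the cusps selected by `P`) are stable under `f + g` (linearity of cusp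
expansions, S50, and the ultrametric inequality in `ℚ̄₃`). [folklore] -/
theorem cuspBound_add {P : SL(2, ℤ) → Prop} {B : SL(2, ℤ) → ℝ} {f g : CuspForm (Gamma0 N) 2}
    (hf : (∀ (γ : SL(2, ℤ)) (ι : PadicAlgCl 3 ≃+* ℂ) (n : ℕ), P γ → ‖ι.symm (fourierCoeffAtCusp N 2 ⇑(f) γ n)‖ ≤ B γ)) (hg : (∀ (γ : SL(2, ℤ)) (ι : PadicAlgCl 3 ≃+* ℂ) (n : ℕ), P γ → ‖ι.symm (fourierCoeffAtCusp N 2 ⇑(g) γ n)‖ ≤ B γ)) : (∀ (γ : SL(2, ℤ)) (ι : PadicAlgCl 3 ≃+* ℂ) (n : ℕ), P γ → ‖ι.symm (fourierCoeffAtCusp N 2 ⇑(f + g) γ n)‖ ≤ B γ) := by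
  intro γ ι n hP
  rw [(hL N f g 0 γ n).1, map_add]
  exact (IsUltrametricDist.norm_add_le_max _ _).trans (max_le (hf γ ι n hP) (hg γ ι n hP))

/-- Cusp bounds are stable under integer multiples (`‖ι⁻¹ z‖ ≤ 1`). [folklore] -/
theorem cuspBound_zsmul {P : SL(2, ℤ) → Prop} {B : SL(2, ℤ) → ℝ} {f : CuspForm (Gamma0 N) 2} (z : ℤ)
    (hf : (∀ (γ : SL(2, ℤ)) (ι : PadicAlgCl 3 ≃+* ℂ) (n : ℕ), P γ → ‖ι.symm (fourierCoeffAtCusp N 2 ⇑(f) γ n)‖ ≤ B γ)) : (∀ (γ : SL(2, ℤ)) (ι : PadicAlgCl 3 ≃+* ℂ) (n : ℕ), P γ → ‖ι.symm (fourierCoeffAtCusp N 2 ⇑(((z : ℤ) : ℂ) • f) γ n)‖ ≤ B γ) := by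
  intro γ ι n hP
  rw [(hL N f f (z : ℂ) γ n).2, map_mul, norm_mul]
  calc ‖ι.symm (z : ℂ)‖ * ‖ι.symm (fourierCoeffAtCusp N 2 ⇑f γ n)‖
      ≤ 1 * ‖ι.symm (fourierCoeffAtCusp N 2 ⇑f γ n)‖ := by
        gcongr; exact AdjunctionKM.norm_symm_intCast_le_one ι z
    _ ≤ B γ := by rw [one_mul]; exact hf γ ι n hP

/-- The zero form satisfies every non-negative cusp bound. [folklore] -/
theorem cuspBound_zero {P : SL(2, ℤ) → Prop} {B : SL(2, ℤ) → ℝ} (hB : ∀ γ, P γ → 0 ≤ B γ) :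
    (∀ (γ : SL(2, ℤ)) (ι : PadicAlgCl 3 ≃+* ℂ) (n : ℕ), P γ → ‖ι.symm (fourierCoeffAtCusp N 2 ⇑((0 : CuspForm (Gamma0 N) 2)) γ n)‖ ≤ B γ) := by
  intro γ ι n hP
  have h := (hL N 0 0 0 γ n).2
  rw [zero_smul] at h
  rw [h, zero_mul, map_zero, norm_zero]
  exact hB γ hP

/-- Cusp bounds are stable under `ℤ`-combinations. [folklore] -/
theorem cuspBound_sum {P : SL(2, ℤ) → Prop} {B : SL(2, ℤ) → ℝ} (hB : ∀ γ, P γ → 0 ≤ B γ) {m : ℕ}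
    (c : Fin m → ℤ) (f : Fin m → CuspForm (Gamma0 N) 2) (hf : ∀ i, (∀ (γ : SL(2, ℤ)) (ι : PadicAlgCl 3 ≃+* ℂ) (n : ℕ), P γ → ‖ι.symm (fourierCoeffAtCusp N 2 ⇑(f i) γ n)‖ ≤ B γ)) :
    (∀ (γ : SL(2, ℤ)) (ι : PadicAlgCl 3 ≃+* ℂ) (n : ℕ), P γ → ‖ι.symm (fourierCoeffAtCusp N 2 ⇑(∑ i : Fin m, ((c i : ℤ) : ℂ) • f i) γ n)‖ ≤ B γ) := by
  refine Finset.sum_induction _ (fun x : CuspForm (Gamma0 N) 2 ↦ ∀ (γ : SL(2, ℤ)) (ι : PadicAlgCl 3 ≃+* ℂ) (n : ℕ), P γ → ‖ι.symm (fourierCoeffAtCusp N 2 ⇑x γ n)‖ ≤ B γ) (fun a b ha hb ↦ cuspBound_add hL ha hb) (cuspBound_zero hL hB) ?_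
  intro i _
  exact cuspBound_zsmul hL (c i) (hf i)

/-- `3 · (cusp-regular)` is strict at the middle cusps (`v₃(N) = 2`): `3⁻¹ · 3^{1/2} ≤ 1`. -/
theorem strict_three_smul (hv : padicValNat 3 N = 2) {f : CuspForm (Gamma0 N) 2}
    (hf : (∀ (γ : SL(2, ℤ)) (ι : PadicAlgCl 3 ≃+* ℂ) (n : ℕ), (fun _ : SL(2, ℤ) ↦ True) γ → ‖ι.symm (fourierCoeffAtCusp N 2 ⇑(f) γ n)‖ ≤ (fun γ : SL(2, ℤ) ↦ (3 : ℝ) ^ (((padicValNat 3 N - padicValNat 3 (cuspDenominator N γ) : ℕ) : ℝ) - cesnaviciusNeururerSahaCuspBound 3 (padicValNat 3 (cuspDenominator N γ)) (padicValNat 3 N))) γ)) :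
    (∀ (γ : SL(2, ℤ)) (ι : PadicAlgCl 3 ≃+* ℂ) (n : ℕ), (fun γ : SL(2, ℤ) ↦ padicValNat 3 (cuspDenominator N γ) = 1) γ → ‖ι.symm (fourierCoeffAtCusp N 2 ⇑(((3 : ℤ) : ℂ) • f) γ n)‖ ≤ (fun _ : SL(2, ℤ) ↦ (1 : ℝ)) γ) := by
  intro γ ι n hγ
  rw [(hL N f f ((3 : ℤ) : ℂ) γ n).2, map_mul, norm_mul, Int.cast_ofNat, AdjunctionKM.norm_symm_three]
  have h := hf γ ι n trivial
  simp only [hv, hγ, cesnaviciusNeururerSahaCuspBound] at h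
  norm_num at h
  calc (3 : ℝ)⁻¹ * ‖ι.symm (fourierCoeffAtCusp N 2 ⇑f γ n)‖ ≤ (3 : ℝ)⁻¹ * (3 : ℝ) ^ ((1 : ℝ) / 2) := by
        gcongr
    _ ≤ (3 : ℝ)⁻¹ * 3 := by
        gcongr
        conv_rhs => rw [← Real.rpow_one 3]
        exact Real.rpow_le_rpow_of_exponent_le (by norm_num) (by norm_num)
    _ = 1 := by norm_num

end closure

omit [NeZero N] in
/-- Rational `q`-expansions at `∞` are stable under addition. [folklore] -/
theorem isRat_add {f g : CuspForm (Gamma0 N) 2} (hf : (∀ n : ℕ, ∃ q : ℚ, (q : ℂ) = cuspCoeff (f) n)) (hg : (∀ n : ℕ, ∃ q : ℚ, (q : ℂ) = cuspCoeff (g) n)) : (∀ n : ℕ, ∃ q : ℚ, (q : ℂ) = cuspCoeff (f + g) n) := by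
  intro n
  obtain ⟨q, hq⟩ := hf n
  obtain ⟨r, hr⟩ := hg n
  refine ⟨q + r, ?_⟩
  have h := cuspCoeff_add_smul f g 1 n
  rw [one_smul, one_mul] at h
  rw [h, ← hq, ← hr]; push_cast; rfl

omit [NeZero N] in
/-- Rational `q`-expansions at `∞` are stable under integer multiples. [folklore] -/
theorem isRat_zsmul {f : CuspForm (Gamma0 N) 2} (z : ℤ) (hf : (∀ n : ℕ, ∃ q : ℚ, (q : ℂ) = cuspCoeff (f) n)) : (∀ n : ℕ, ∃ q : ℚ, (q : ℂ) = cuspCoeff (((z : ℤ) : ℂ) • f) n) := by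
  intro n
  obtain ⟨q, hq⟩ := hf n
  refine ⟨z * q, ?_⟩
  rw [cuspCoeff_smul, ← hq]; push_cast; rfl

omit [NeZero N] in
/-- The zero form has rational `q`-expansion. [folklore] -/
theorem isRat_zero : (∀ n : ℕ, ∃ q : ℚ, (q : ℂ) = cuspCoeff ((0 : CuspForm (Gamma0 N) 2)) n) := by
  intro n
  refine ⟨0, ?_⟩
  have h := cuspCoeff_smul (0 : ℂ) (0 : CuspForm (Gamma0 N) 2) n
  rw [zero_smul] at h
  rw [h]; simp

omit [NeZero N] in
/-- Rational `q`-expansions at `∞` are stable under `ℤ`-combinations. [folklore] -/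
theorem isRat_sum {m : ℕ} (c : Fin m → ℤ) (f : Fin m → CuspForm (Gamma0 N) 2) (hf : ∀ i, (∀ n : ℕ, ∃ q : ℚ, (q : ℂ) = cuspCoeff (f i) n)) :
    (∀ n : ℕ, ∃ q : ℚ, (q : ℂ) = cuspCoeff (∑ i : Fin m, ((c i : ℤ) : ℂ) • f i) n) := by
  refine Finset.sum_induction _ (fun x : CuspForm (Gamma0 N) 2 ↦ ∀ n : ℕ, ∃ q : ℚ, (q : ℂ) = cuspCoeff x n) (fun a b ha hb ↦ isRat_add ha hb) isRat_zero ?_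
  intro i _
  exact isRat_zsmul (c i) (hf i)

/-- **LINE 50 composition (kernel-checked):** the residue rank bound on the `(1,1)`-component, the
twisted-oldform residue basis and linearity of cusp expansions imply RL47 (`CuspRegularResidueLaw`)
by name — linear algebra over `𝔽₃` on `L_reg / L_strict`. -/
theorem cuspRegularResidueLaw_of_residuesOnE (hA : MiddleResidueRankBound)
    (hB : TwistedOldformResidueBasis) (hL : FourierCoeffAtCuspLinear) : CuspRegularResidueLaw := by
  intro N _ hv h9 χ hχ hprim b hbrat hbreg
  obtain ⟨m, h, hm, hold, hrat, hreg, hind⟩ := hB N hv h9 χ hχ hprim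
  -- the twist as a linear map
  let Rl : CuspForm (Gamma0 N) 2 →ₗ[ℂ] CuspForm (Gamma0 N) 2 :=
    { toFun := charTwist N (dvd_refl _) h9 hχ
      map_add' := Summit.BirchSwinnertonDyer.Rank1Residual.O5.charTwist_add h9 hχ hprim
      map_smul' := Summit.BirchSwinnertonDyer.Rank1Residual.O5.charTwist_smul h9 hχ hprim }
  have hRl : ∀ x, Rl x = charTwist N (dvd_refl _) h9 hχ x := fun _ ↦ rfl
  -- the family `b, R h₁, …, R h_m`
  let G : Fin (m + 1) → CuspForm (Gamma0 N) 2 :=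
    fun i ↦ Fin.cases b (fun j ↦ charTwist N (dvd_refl _) h9 hχ (h j)) i
  have hG0 : G 0 = b := rfl
  have hGs : ∀ j : Fin m, G j.succ = charTwist N (dvd_refl _) h9 hχ (h j) := fun _ ↦ rfl
  have hGrat : ∀ i : Fin (m + 1), ∀ n : ℕ, ∃ q : ℚ, (q : ℂ) = cuspCoeff (G i) n := by
    intro i; refine Fin.cases ?_ (fun j ↦ ?_) i
    · exact hbrat
    · exact hrat j
  have hGreg : ∀ (i : Fin (m + 1)) (γ : SL(2, ℤ)) (ι : PadicAlgCl 3 ≃+* ℂ) (n : ℕ),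
      ‖ι.symm (fourierCoeffAtCusp N 2 ⇑(G i) γ n)‖ ≤ (3 : ℝ) ^ (((padicValNat 3 N - padicValNat 3 (cuspDenominator N γ) : ℕ) : ℝ) - cesnaviciusNeururerSahaCuspBound 3 (padicValNat 3 (cuspDenominator N γ)) (padicValNat 3 N)) := by
    intro i; refine Fin.cases ?_ (fun j ↦ ?_) i
    · exact hbreg
    · exact hreg j
  have hdim : Module.finrank ℂ (CuspForm (Gamma0 (N / 3)) 2) <
      (m + 1) + Module.finrank ℂ (CuspForm (Gamma0 (N / 9)) 2) := by omega
  obtain ⟨c, ⟨j, hj⟩, hstrict⟩ := hA N hv (m + 1) G hGrat hGreg hdim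
  -- abbreviations
  have hsplit : (∑ i : Fin (m + 1), ((c i : ℤ) : ℂ) • G i) =
      ((c 0 : ℤ) : ℂ) • b + ∑ i : Fin m, ((c i.succ : ℤ) : ℂ) • charTwist N (dvd_refl _) h9 hχ (h i) := by
    rw [Fin.sum_univ_succ]; rfl
  -- predicates
  have hBmid : ∀ γ : SL(2, ℤ), padicValNat 3 (cuspDenominator N γ) = 1 → (0 : ℝ) ≤ (fun _ ↦ (1 : ℝ)) γ :=
    fun _ _ ↦ zero_le_one
  have hBreg : ∀ γ : SL(2, ℤ), (fun _ : SL(2, ℤ) ↦ True) γ → 0 ≤ (fun γ : SL(2, ℤ) ↦ (3 : ℝ) ^ (((padicValNat 3 N - padicValNat 3 (cuspDenominator N γ) : ℕ) : ℝ) - cesnaviciusNeururerSahaCuspBound 3 (padicValNat 3 (cuspDenominator N γ)) (padicValNat 3 N))) γ := fun γ _ ↦ by positivity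
  -- the strict combination `S = Σ cᵢ Gᵢ`
  have hSstrict : (∀ (γ : SL(2, ℤ)) (ι : PadicAlgCl 3 ≃+* ℂ) (n : ℕ), (fun γ : SL(2, ℤ) ↦ padicValNat 3 (cuspDenominator N γ) = 1) γ → ‖ι.symm (fourierCoeffAtCusp N 2 ⇑(∑ i : Fin (m + 1), ((c i : ℤ) : ℂ) • G i) γ n)‖ ≤ (fun _ : SL(2, ℤ) ↦ (1 : ℝ)) γ) := fun γ ι n hγ ↦ hstrict γ ι n hγ
  have hSreg : (∀ (γ : SL(2, ℤ)) (ι : PadicAlgCl 3 ≃+* ℂ) (n : ℕ), (fun _ : SL(2, ℤ) ↦ True) γ → ‖ι.symm (fourierCoeffAtCusp N 2 ⇑(∑ i : Fin (m + 1), ((c i : ℤ) : ℂ) • G i) γ n)‖ ≤ (fun γ : SL(2, ℤ) ↦ (3 : ℝ) ^ (((padicValNat 3 N - padicValNat 3 (cuspDenominator N γ) : ℕ) : ℝ) - cesnaviciusNeururerSahaCuspBound 3 (padicValNat 3 (cuspDenominator N γ)) (padicValNat 3 N))) γ) :=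
    cuspBound_sum hL hBreg c G (fun i γ ι n _ ↦ hGreg i γ ι n)
  have hSrat : (∀ n : ℕ, ∃ q : ℚ, (q : ℂ) = cuspCoeff (∑ i : Fin (m + 1), ((c i : ℤ) : ℂ) • G i) n) := isRat_sum c G hGrat
  have hb3 : (∀ (γ : SL(2, ℤ)) (ι : PadicAlgCl 3 ≃+* ℂ) (n : ℕ), (fun γ : SL(2, ℤ) ↦ padicValNat 3 (cuspDenominator N γ) = 1) γ → ‖ι.symm (fourierCoeffAtCusp N 2 ⇑(((3 : ℤ) : ℂ) • b) γ n)‖ ≤ (fun _ : SL(2, ℤ) ↦ (1 : ℝ)) γ) :=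
    strict_three_smul hL hv (fun γ ι n _ ↦ hbreg γ ι n)
  by_cases h3 : (3 : ℤ) ∣ c 0
  · -- then `Σ c_{i+1} R hᵢ` is strict, so all `c_{i+1}` are divisible by 3: contradiction
    exfalso
    obtain ⟨k, hk⟩ := h3
    have hT : (∀ (γ : SL(2, ℤ)) (ι : PadicAlgCl 3 ≃+* ℂ) (n : ℕ), (fun γ : SL(2, ℤ) ↦ padicValNat 3 (cuspDenominator N γ) = 1) γ → ‖ι.symm (fourierCoeffAtCusp N 2 ⇑(∑ i : Fin m, ((c i.succ : ℤ) : ℂ) • charTwist N (dvd_refl _) h9 hχ (h i)) γ n)‖ ≤ (fun _ : SL(2, ℤ) ↦ (1 : ℝ)) γ) := by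
      have hE : (∑ i : Fin m, ((c i.succ : ℤ) : ℂ) • charTwist N (dvd_refl _) h9 hχ (h i)) =
          (∑ i : Fin (m + 1), ((c i : ℤ) : ℂ) • G i) + (((-k) : ℤ) : ℂ) • ((((3 : ℤ) : ℂ)) • b) := by
        rw [hsplit, hk, smul_smul]; push_cast; module
      rw [hE]
      exact cuspBound_add hL hSstrict (cuspBound_zsmul hL (-k) hb3)
    have hall := hind (fun i ↦ c i.succ) hT
    revert hj
    refine Fin.cases ?_ (fun i ↦ ?_) j
    · exact fun hj ↦ hj ⟨k, hk⟩
    · exact fun hj ↦ hj (hall i)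
  · -- `c₀` is prime to 3: Bezout `u·3 + v·c₀ = 1`
    have hcop : IsCoprime (3 : ℤ) (c 0) := (Int.prime_three.coprime_iff_not_dvd).mpr h3
    obtain ⟨u, v, huv⟩ := hcop
    have hc : ((u : ℤ) : ℂ) * 3 + ((v : ℤ) : ℂ) * ((c 0 : ℤ) : ℂ) = 1 := by exact_mod_cast congrArg (Int.cast : ℤ → ℂ) huv
    refine ⟨((v : ℤ) : ℂ) • (∑ i : Fin (m + 1), ((c i : ℤ) : ℂ) • G i) + ((u : ℤ) : ℂ) • (((3 : ℤ) : ℂ) • b),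
      ∑ i : Fin m, ((-(v * c i.succ) : ℤ) : ℂ) • h i, ?_, ?_, ?_, ?_, ?_⟩
    · exact Submodule.sum_mem _ fun i _ ↦ Submodule.smul_mem _ _ (hold i)
    · exact isRat_add (isRat_zsmul v hSrat) (isRat_zsmul u (isRat_zsmul 3 hbrat))
    · intro γ ι n
      have hR : (∀ (γ : SL(2, ℤ)) (ι : PadicAlgCl 3 ≃+* ℂ) (n : ℕ), (fun _ : SL(2, ℤ) ↦ True) γ → ‖ι.symm (fourierCoeffAtCusp N 2 ⇑(((v : ℤ) : ℂ) • (∑ i : Fin (m + 1), ((c i : ℤ) : ℂ) • G i) + ((u : ℤ) : ℂ) • (((3 : ℤ) : ℂ) • b)) γ n)‖ ≤ (fun γ : SL(2, ℤ) ↦ (3 : ℝ) ^ (((padicValNat 3 N - padicValNat 3 (cuspDenominator N γ) : ℕ) : ℝ) - cesnaviciusNeururerSahaCuspBound 3 (padicValNat 3 (cuspDenominator N γ)) (padicValNat 3 N))) γ) :=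
        cuspBound_add hL (cuspBound_zsmul hL v hSreg) (cuspBound_zsmul hL u (cuspBound_zsmul hL 3 (fun γ ι n _ ↦ hbreg γ ι n)))
      exact hR γ ι n trivial
    · intro γ ι n hγ
      have hS1 : (∀ (γ : SL(2, ℤ)) (ι : PadicAlgCl 3 ≃+* ℂ) (n : ℕ), (fun γ : SL(2, ℤ) ↦ padicValNat 3 (cuspDenominator N γ) = 1) γ → ‖ι.symm (fourierCoeffAtCusp N 2 ⇑(((v : ℤ) : ℂ) • (∑ i : Fin (m + 1), ((c i : ℤ) : ℂ) • G i) + ((u : ℤ) : ℂ) • (((3 : ℤ) : ℂ) • b)) γ n)‖ ≤ (fun _ : SL(2, ℤ) ↦ (1 : ℝ)) γ) :=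
        cuspBound_add hL (cuspBound_zsmul hL v hSstrict) (cuspBound_zsmul hL u hb3)
      exact hS1 γ ι n hγ
    · -- the identity `b = v·S + u·3·b − v·Σ c_{i+1} R hᵢ`
      have hRsum : charTwist N (dvd_refl _) h9 hχ (∑ i : Fin m, ((-(v * c i.succ) : ℤ) : ℂ) • h i) =
          (-((v : ℤ) : ℂ)) • ∑ i : Fin m, ((c i.succ : ℤ) : ℂ) • charTwist N (dvd_refl _) h9 hχ (h i) := by
        rw [← hRl, map_sum, Finset.smul_sum]
        refine Finset.sum_congr rfl fun i _ ↦ ?_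
        rw [map_smul, hRl, smul_smul]; push_cast; ring_nf
      rw [hRsum, hsplit]
      set T := ∑ i : Fin m, ((c i.succ : ℤ) : ℂ) • charTwist N (dvd_refl _) h9 hχ (h i) with hT
      calc b = (((u : ℤ) : ℂ) * 3 + ((v : ℤ) : ℂ) * ((c 0 : ℤ) : ℂ)) • b := by rw [hc, one_smul]
        _ = _ := by push_cast; module

/-- The glue item BY NAME: closes `TameQuarticManinParity.CuspRegularResidueLawOfResiduesOnE`
(stmt-BirchSwinnertonDyer-23766). -/
theorem cuspRegularResidueLawOfResiduesOnE_holds :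
    Summit.BirchSwinnertonDyer.BirchSwinnertonDyer.Theses.TameQuarticManinParity.CuspRegularResidueLawOfResiduesOnE :=
  cuspRegularResidueLaw_of_residuesOnE

end Summit.BirchSwinnertonDyer.BirchSwinnertonDyer.Theorems.TameQuarticManinParity.ResiduesOnE
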